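import Literature.Probability.RandomPlanarGeometry.SAWPulledFreeEnergyZ2
import Literature.Probability.RandomPlanarGeometry.SAWPulledBridgeGain
import Literature.Probability.RandomPlanarGeometry.SAWPulledBridgeFreeEnergy
import Literature.Probability.RandomPlanarGeometry.SAWUnfoldingSpan
import Literature.Probability.RandomPlanarGeometry.HammersleyWelshBound
import HarnessLib

/-!
# The three pulled ensembles have ONE free energy for `y ≥ 1`: bridges, half-space walks, drifted walks
# (Janse van Rensburg–Whittington 2016, Theorem 3, in the tree's ensembles, with explicit constants)

Topic `Literature/Probability/RandomPlanarGeometry` (continues `SAWPulledFreeEnergyZ2.lean` — the objects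
`Zd.pulledBridgeZ d N y = Z^B_N(y) = Σ_{β ∈ B_N} y^{span β}`, `Zd.driftZ d N θ = Z_N(θ) = Σ_{ω ∈ SAW_N} e^{θ x₁(ω_N)}` —,
`SAWPulledBridgeGain.lean` — `Zd.pulledHalfSpaceZ d N y = Z^H_N(y) = Σ_{ω ∈ H_N} y^{x₁(ω_N)}`, supermultiplicativity
`Zd.pulledBridgeZ_mul_le`, the trivial sandwich `Zd.pulledBridgeZ_le_pulledHalfSpaceZ_le_driftZ` —, the unfolding files
`SAWUnfolding.lean` / `SAWUnfoldingSpan.lean` (Hammersley–Welsh / Madras–Slade unfolding `Zd.unfold`, its code, the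
injectivity `Zd.unfold_code_injOn`, `#codes ≤ e^{3√n}`) and `SAWBridges.lean` (the last-minimum splitting
`Zd.lastMin` / `Zd.headWalk` / `Zd.tailWalk` behind Madras–Slade (3.1.7))).

Source. E. J. Janse van Rensburg, S. G. Whittington, *Self-avoiding walks subject to a force*, J. Phys. A:
Math. Theor. 49 (2016) 11LT01 (arXiv:1510.06698), §2–§3. With `C⁺(y,z) = Σ_n C⁺_n(1,y) zⁿ` (positive walks
weighted `y^{height of the last vertex}`), `C(y,z)` (positive walks weighted `y^{span}`) and `B(y,z) = Σ b_n(h) y^h zⁿ`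
(bridges), AS PRINTED (p. 4, Theorem 3): **"The radii of convergence of the generating functions `C(y,z)`,
`C⁺(y,z)` and `B(y,z)` are all equal when `y ≥ 1`."** Proof as printed: "`B(y,z) ≤ C⁺(y,z) ≤ C(y,z)`, `y > 1`" by
inclusion and `s ≥ h`; "Each walk counted by `C(y,z)` can be converted to a bridge by unfolding in the
`x_d`-direction and at most `e^{O(√n)}` such walks give the same bridge [HammersleyWelsh]. Moreover the span can not
decrease in the unfolding operation so, for `y > 1`, `C_n(1,y) ≤ e^{O(√n)} B_n(y)`."

## What is proved here (all `theorem`s; no new definitions, no named facts)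

The same statement for the tree's three ensembles on `ℤ^d` (first coordinate as the pulled direction), with
explicit constants, every dimension, every length:

* `Zd.apply_last_le_unfold_last` — the endpoint level of a walk is at most the span of its unfolding
  ("the span can not decrease in the unfolding operation");
* **`Zd.pulledHalfSpaceZ_le_card_mul_pulledBridgeZ`**, **`Zd.pulledHalfSpaceZ_le_exp_mul_pulledBridgeZ`** —
  `Z^H_N(y) ≤ #{codes} · Z^B_N(y) ≤ e^{3√N} Z^B_N(y)` for `y ≥ 1` (M–S strict half-space walks weighted by the
  endpoint HEIGHT — the analogue, for the tree's ensemble, of the printed `C_n(1,y) ≤ e^{O(√n)} B_n(y)`, with the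
  tree's code bound `e^{3√n}` in place of the partition number; the printed SPAN weight is not used here);
* `Zd.splitLastMin_injOn` — the last-minimum splitting `ω ↦ (m, head, tail)` of Madras–Slade (3.1.7) is
  injective (the tree proves this inside `Zd.count_le_sum_halfSpaceCount`; restated as a lemma);
* **`Zd.driftZ_le_sum_halfSpaceCount_mul_pulledHalfSpaceZ`** — `Z_N(θ) ≤ Σ_{m=0}^{N} h_{m+1} · Z^H_{N-m}(e^θ)` for
  `θ ≥ 0`: the drift weight of a full-space walk is at most that of its tail after the last minimum of `x₁`
  (not located in print with the drift weight; elementary from (3.1.7));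
* **`Zd.driftZ_le_mul_exp_mul_pulledBridgeZ_succ`** — `Z_N(θ) ≤ (N+1) e^{6√(N+1)} Z^B_{N+1}(e^θ)` for `θ ≥ 0`
  (with `h_n ≤ e^{3√n} b_n`, `b_n ≤ Z^B_n(y)` for `y ≥ 1`, and `Z^B_m Z^B_n ≤ Z^B_{m+n}`);
* `Zd.sum_pow_le_driftZ_of_subset`, `Zd.pulledBridgeZ_le_sum_pow_of_bridges_subset`,
  **`Zd.tendsto_log_sum_pow_div_of_pulledBridgeZ`** — any intermediate ensemble `bridges ⊆ T_N ⊆ saws` with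
  non-negative endpoint levels (Beaton's weak-half-space `U_N(y)`, JvR–W's `C⁺_N`) is sandwiched and has the same
  free energy;
* **`Zd.tendsto_log_pulledHalfSpaceZ_div_of_pulledBridgeZ`**, **`Zd.tendsto_log_driftZ_div_of_pulledBridgeZ`** —
  if `N⁻¹ log Z^B_N(y) → λ` then `N⁻¹ log Z^H_N(y) → λ` and `N⁻¹ log Z_N(log y) → λ` (`y ≥ 1`): the three pulled
  free energies coincide whenever the bridge one exists (it does, by Fekete on `Zd.pulledBridgeZ_mul_le` — lane
  item X29; not restated here).

* (appended, with `SAWPulledBridgeFreeEnergy.lean` = the bridge free energy `λ_B = Zd.pulledBridgeFreeEnergy`,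
  a limit for every `y > 0` by Fekete) **`Zd.tendsto_log_pulledHalfSpaceZ_div`**, **`Zd.tendsto_log_driftZ_div`**,
  **`Zd.tendsto_log_sum_pow_div`** — `N⁻¹ log Z^H_N(y) → λ_B(y)`, `N⁻¹ log Z_N(θ) → λ_B(e^θ)`, and the same for
  any sandwiched ensemble: the three pulled free energies EXIST and are EQUAL (`y ≥ 1` / `θ ≥ 0`), unconditionally;
* **`Zd.JansevanRensburgWhittington2016_thm3_bridge_height`** — Theorem 3 in its radius-of-convergence form FOR
  THE TREE'S BRIDGE / HEIGHT-WEIGHTED ENSEMBLES (not the printed triple): for `y ≥ 1` the power series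
  `Σ_N Z^B_N(y) z^N` (bridges = the printed `B`), `Σ_N Z^H_N(y) z^N` (strict half-space walks, height weight) and
  `Σ_N Z_N(log y) z^N` (all walks, drift — not a printed ensemble) converge for `0 ≤ z < e^{-λ_B(y)}` and diverge
  for `z > e^{-λ_B(y)}` (Cauchy–Hadamard from the limits). **The span-weighted ensemble `C(y,z)` of the printed
  theorem is NOT typed here**; the printed height-weighted positive-walk ensemble `C⁺` (= Beaton's `U_n`) is
  covered by the sandwich theorem `Zd.tendsto_log_sum_pow_div` (explicit instance: `SAWPulledHalfSpaceFreeEnergy`).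

Consequence for the lane «pcv-sawmu» (X26 «PULL-ENCL»): the certified window for `e^{λ_B(2)}` on `ℤ²`, built from
a LOWER bound on `Z^B_N(2)` and an UPPER bound on the full-space `Z_N(log 2)`, encloses ONE number — the common
pulled free energy of bridges, half-space walks (Beaton's `U_n` lies between `Z^H_N` and `Z_N`) and drifted walks.

Deviations (labelled): the printed statement is about radii of convergence of positive (weak half-space) walk
generating functions; here the ensembles are the tree's (bridges ⊆ M–S half-space walks ⊆ all walks, drift
weight `e^{θ x₁(ω_N)}` on all walks), the sub-exponential factor is the tree's explicit `e^{3√n}`, and the limit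
statements are given in `Tendsto` form conditional on the bridge limit, then unconditionally via `λ_B`
(`SAWPulledBridgeFreeEnergy.lean`), and finally in radius-of-convergence form for THESE ensembles. The full-space
drift clause is not in the printed Theorem 3 (positive walks only), and the printed SPAN-weighted ensemble `C(y,z)`
is not typed in this file (only `B`, and `C⁺` through the sandwich theorem).

Tree-twin search: `grep -rn "11LT01\|1510.06698\|radius of convergence.*pull\|pulledHalfSpaceZ_le\|driftZ_le"
Literature/Probability/RandomPlanarGeometry` → only the trivial directions (`pulledBridgeZ_le_driftZ`,
`pulledBridgeZ_le_pulledHalfSpaceZ_le_driftZ`). No twin.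
-/


open Finset Filter Topology Literature.Probability.LatticeModels
open Literature.Probability.RandomPlanarGeometry.SAW
open scoped BigOperators

namespace Literature.Probability.RandomPlanarGeometry.SAW.Zd

open Literature.Combinatorics.Enumerative

section HalfSpace

variable {d : ℕ} [NeZero d]

/-- **"The span can not decrease in the unfolding operation"**: the endpoint level `x₁(ω_n)` of an `n`-step
self-avoiding walk is at most the endpoint level (= span) of its full unfolding `unfold n ω` — indeed
`x₁(ω_n) ≤ max_i x₁(ω_i) ≤ x₁((unfold ω)_n)` (`Zd.code_sum_le_span`).
[cite: JansevanRensburgWhittington2016, proof of Theorem 3; MadrasSlade1993, §3.1 (proof of Proposition 3.1.5)] -/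
theorem apply_last_le_unfold_last {n : ℕ} {ω : ℕ → Site d} (hω : ω ∈ saws d n) :
    ω n 0 ≤ unfold n ω n 0 := by
  have h1 : ω n 0 ≤ maxLevel n ω := apply_le_maxLevel ω le_rfl
  have h2 : (((code n ω).sum id : ℕ) : ℤ) ≤ unfold n ω n 0 - maxLevel n ω := code_sum_le_span hω
  have h3 : (0 : ℤ) ≤ (((code n ω).sum id : ℕ) : ℤ) := Nat.cast_nonneg _
  linarith

/-- `Z^B_n(y) ≥ 0` for `y ≥ 0`. [cite: JansevanRensburgWhittington2016, §2 (B(y,z))] -/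
theorem pulledBridgeZ_nonneg (n : ℕ) {y : ℝ} (hy : 0 ≤ y) : 0 ≤ pulledBridgeZ d n y := by
  rw [pulledBridgeZ_eq_sum_bridges]
  exact Finset.sum_nonneg fun _ _ => pow_nonneg hy _

/-- `b_n ≤ Z^B_n(y)` for `y ≥ 1` (every bridge has weight `y^{span} ≥ 1`).
[cite: JansevanRensburgWhittington2016, §2 (B(y,z)); MadrasSlade1993, Definition 1.2.4] -/
theorem bridgeCount_le_pulledBridgeZ (n : ℕ) {y : ℝ} (hy : 1 ≤ y) :
    (bridgeCount d n : ℝ) ≤ pulledBridgeZ d n y := by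
  classical
  rw [pulledBridgeZ_eq_sum_bridges, bridgeCount]
  have : ((bridges d n).card : ℝ) = ∑ _ω ∈ bridges d n, (1 : ℝ) := by simp
  rw [this]
  exact Finset.sum_le_sum fun ω _ => one_le_pow₀ hy

open Classical in
/-- **`Z^H_n(y) ≤ #{codes} · Z^B_n(y)` for `y ≥ 1`** — the weighted form of Madras–Slade (3.1.4)/(3.1.5): group
the half-space walks by their unfolding code; on each code class `ω ↦ unfold ω` is injective into the bridges and
does not decrease the weight `y^{x₁(ω_n)}`.
[cite: JansevanRensburgWhittington2016, Theorem 3 (proof: "C_n(1,y) ≤ e^{O(√n)} B_n(y)"); MadrasSlade1993, §3.1, eqs. (3.1.4)–(3.1.5)] -/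
theorem pulledHalfSpaceZ_le_card_mul_pulledBridgeZ (n : ℕ) {y : ℝ} (hy : 1 ≤ y) :
    pulledHalfSpaceZ d n y ≤ ((finsetsOfSumLE n).card : ℝ) * pulledBridgeZ d n y := by
  have hy0 : 0 ≤ y := zero_le_one.trans hy
  have hT : halfSpaceWalks d n ⊆ saws d n := fun ω hω => (mem_halfSpaceWalks.1 hω).1
  -- (1) termwise: `y^{x₁(ω_n)} ≤ y^{span(unfold ω)}`
  have step1 : pulledHalfSpaceZ d n y ≤ ∑ ω ∈ halfSpaceWalks d n, y ^ (unfold n ω n 0).toNat := by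
    unfold pulledHalfSpaceZ
    exact Finset.sum_le_sum fun ω hω =>
      pow_le_pow_right₀ hy (Int.toNat_le_toNat (apply_last_le_unfold_last (hT hω)))
  -- (2) reindex by `(unfold ω, code ω)`, injective on self-avoiding walks
  let F : (ℕ → Site d) → (ℕ → Site d) × Finset ℕ := fun ω => (unfold n ω, code n ω)
  have hinj : Set.InjOn F ↑(halfSpaceWalks d n) := fun ω hω ω' hω' h =>
    unfold_code_injOn n (hT hω) (hT hω') h
  have step2 : ∑ ω ∈ halfSpaceWalks d n, y ^ (unfold n ω n 0).toNat =
      ∑ p ∈ (halfSpaceWalks d n).image F, y ^ (p.1 n 0).toNat := by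
    rw [Finset.sum_image hinj]
  -- (3) the image lies in `bridges × codes`
  have hsub : (halfSpaceWalks d n).image F ⊆ bridges d n ×ˢ finsetsOfSumLE n := by
    intro p hp
    obtain ⟨ω, hω, rfl⟩ := Finset.mem_image.1 hp
    exact Finset.mem_product.2 ⟨unfold_mem_bridges hω, code_mem_finsetsOfSumLE (hT hω)⟩
  have step3 : ∑ p ∈ (halfSpaceWalks d n).image F, y ^ (p.1 n 0).toNat ≤
      ∑ p ∈ bridges d n ×ˢ finsetsOfSumLE n, y ^ (p.1 n 0).toNat :=
    Finset.sum_le_sum_of_subset_of_nonneg hsub fun _ _ _ => pow_nonneg hy0 _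
  -- (4) the full product sum is `#codes · Z^B_n(y)`
  have step4 : ∑ p ∈ bridges d n ×ˢ finsetsOfSumLE n, y ^ (p.1 n 0).toNat =
      ((finsetsOfSumLE n).card : ℝ) * pulledBridgeZ d n y := by
    rw [Finset.sum_product, pulledBridgeZ_eq_sum_bridges, Finset.mul_sum]
    refine Finset.sum_congr rfl fun β _ => ?_
    show ∑ _c ∈ finsetsOfSumLE n, y ^ (β n 0).toNat = _
    rw [Finset.sum_const, nsmul_eq_mul]
  calc pulledHalfSpaceZ d n y ≤ ∑ ω ∈ halfSpaceWalks d n, y ^ (unfold n ω n 0).toNat := step1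
    _ = ∑ p ∈ (halfSpaceWalks d n).image F, y ^ (p.1 n 0).toNat := step2
    _ ≤ ∑ p ∈ bridges d n ×ˢ finsetsOfSumLE n, y ^ (p.1 n 0).toNat := step3
    _ = ((finsetsOfSumLE n).card : ℝ) * pulledBridgeZ d n y := step4

/-- **`Z^H_n(y) ≤ e^{3√n} · Z^B_n(y)` for `y ≥ 1`** (Janse van Rensburg–Whittington 2016, proof of Theorem 3:
"`C_n(1,y) ≤ e^{O(√n)} B_n(y)`", here for M–S half-space walks with the endpoint weight and the tree's explicit code
bound `#{codes} ≤ e^{3√n}`). Together with `Z^B_n ≤ Z^H_n` (`pulledBridgeZ_le_pulledHalfSpaceZ_le_driftZ`) the bridge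
and half-space pulled free energies coincide for `y ≥ 1`.
[cite: JansevanRensburgWhittington2016, Theorem 3; MadrasSlade1993, Proposition 3.1.5] -/
theorem pulledHalfSpaceZ_le_exp_mul_pulledBridgeZ (n : ℕ) {y : ℝ} (hy : 1 ≤ y) :
    pulledHalfSpaceZ d n y ≤ Real.exp (3 * Real.sqrt n) * pulledBridgeZ d n y :=
  (pulledHalfSpaceZ_le_card_mul_pulledBridgeZ n hy).trans
    (mul_le_mul_of_nonneg_right (card_finsetsOfSumLE_le_exp n)
      (pulledBridgeZ_nonneg n (zero_le_one.trans hy)))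

end HalfSpace

/-! ## The full-space drifted ensemble: splitting at the last minimum of `x₁` -/

section FullSpace

variable {d : ℕ} [NeZero d]

/-- **The last-minimum splitting is injective**: an `n`-step self-avoiding walk `ω` is recovered from
`m = lastMin n ω` (the last time its first coordinate is minimal), its head piece (up to `m`, reversed, one extra
step) and its tail piece (after `m`). This is the injectivity behind Madras–Slade (3.1.7)
`c_n ≤ Σ_m h_{m+1} h_{n-m}`; the tree proves it inside `Zd.count_le_sum_halfSpaceCount`, restated here as a lemma.
[cite: MadrasSlade1993, §3.1, proof of Theorem 3.1.1, eq. (3.1.7)] -/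
theorem splitLastMin_injOn (n : ℕ) :
    Set.InjOn (fun ω : ℕ → Site d =>
      (⟨lastMin n ω, (headWalk n ω, tailWalk n ω)⟩ : Σ _ : ℕ, (ℕ → Site d) × (ℕ → Site d)))
      ↑(saws d n) := by
  intro ω hω ω' hω' h
  rw [Finset.mem_coe] at hω hω'
  simp only [Sigma.mk.inj_iff] at h
  obtain ⟨hmm, h⟩ := h
  have h' : (headWalk n ω, tailWalk n ω) = (headWalk n ω', tailWalk n ω') := eq_of_heq h
  simp only [Prod.mk.injEq] at h'
  obtain ⟨hh, ht⟩ := h'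
  obtain ⟨h0, hend, -, -⟩ := mem_saws.1 hω
  obtain ⟨h0', hend', -, -⟩ := mem_saws.1 hω'
  obtain ⟨m, hm⟩ : ∃ m, lastMin n ω = m := ⟨_, rfl⟩
  have hm' : lastMin n ω' = m := hmm.symm.trans hm
  have hmn : m ≤ n := hm ▸ lastMin_le n ω
  -- recover `ω m` from the last vertex of the head piece
  have hωm : ω m = ω' m := by
    have := congrFun hh (m + 1)
    rw [headWalk_apply hm, headWalk_apply hm', if_neg (by omega), if_neg (by omega), min_self,
      Nat.sub_self, h0, h0', add_left_inj, zero_sub, zero_sub, neg_inj] at this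
    exact this
  funext i
  rcases le_or_gt i m with hi | hi
  · rcases Nat.eq_zero_or_pos (m - i) with h | h
    · have : i = m := by omega
      rw [this, hωm]
    · have := congrFun hh (m + 1 - i)
      rw [headWalk_apply hm, headWalk_apply hm', if_neg (by omega), if_neg (by omega),
        min_eq_left (by omega : m + 1 - i ≤ m + 1), show m + 1 - (m + 1 - i) = i by omega,
        hωm, add_left_inj, sub_left_inj] at this
      exact this
  · rcases le_or_gt i n with hin | hin
    · have := congrFun ht (i - m)
      rw [tailWalk_apply hm, tailWalk_apply hm', min_eq_left (by omega : i - m ≤ n - m),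
        show m + (i - m) = i by omega, hωm, sub_left_inj] at this
      exact this
    · have := congrFun ht (n - m)
      rw [tailWalk_apply hm, tailWalk_apply hm', min_self, show m + (n - m) = n by omega, hωm,
        sub_left_inj] at this
      rw [hend i hin.le, hend' i hin.le, this]

/-- The drift weight of a walk is at most the pulled weight of its tail piece: with `m = lastMin n ω`,
`x₁(ω_n) ≤ x₁(ω_n) - x₁(ω_m) = x₁(tail_{n-m})` (the minimum is `≤ x₁(ω_0) = 0`), so for `θ ≥ 0`,
`e^{θ x₁(ω_n)} ≤ (e^θ)^{x₁(tail_{n-m})}`. [cite: MadrasSlade1993, §3.1, proof of Theorem 3.1.1 (the splitting); not located in print with the drift weight — elementary] -/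
theorem exp_mul_apply_le_pow_tailWalk {n : ℕ} {ω : ℕ → Site d} (hω : ω ∈ saws d n) {θ : ℝ} (hθ : 0 ≤ θ) :
    Real.exp (θ * ((ω n 0 : ℤ) : ℝ)) ≤
      Real.exp θ ^ (tailWalk n ω (n - lastMin n ω) 0).toNat := by
  obtain ⟨h0, -, -, -⟩ := mem_saws.1 hω
  obtain ⟨m, hm⟩ : ∃ m, lastMin n ω = m := ⟨_, rfl⟩
  have hmn : m ≤ n := hm ▸ lastMin_le n ω
  have hmin0 : ω m 0 ≤ ω 0 0 := hm ▸ apply_lastMin_le (Nat.zero_le n)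
  have hminn : ω m 0 ≤ ω n 0 := hm ▸ apply_lastMin_le le_rfl
  have h00 : ω 0 0 = 0 := by rw [h0]; rfl
  have htail : tailWalk n ω (n - lastMin n ω) 0 = ω n 0 - ω m 0 := by
    rw [hm, tailWalk_apply hm, min_self, show m + (n - m) = n by omega, Pi.sub_apply]
  have hnn : 0 ≤ ω n 0 - ω m 0 := sub_nonneg.2 hminn
  have hle : ω n 0 ≤ ω n 0 - ω m 0 := by linarith
  rw [htail, ← Real.exp_nat_mul]
  refine Real.exp_le_exp.2 ?_
  have hcast : (((ω n 0 - ω m 0).toNat : ℕ) : ℝ) = (((ω n 0 - ω m 0 : ℤ)) : ℝ) := by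
    have : (((ω n 0 - ω m 0).toNat : ℕ) : ℤ) = ω n 0 - ω m 0 := Int.toNat_of_nonneg hnn
    exact_mod_cast this
  rw [hcast]
  have hle' : ((ω n 0 : ℤ) : ℝ) ≤ ((ω n 0 - ω m 0 : ℤ) : ℝ) := by exact_mod_cast hle
  nlinarith [mul_le_mul_of_nonneg_left hle' hθ]

open Classical in
/-- **`Z_n(θ) ≤ Σ_{m=0}^{n} h_{m+1} · Z^H_{n-m}(e^θ)` for `θ ≥ 0`** — Madras–Slade's splitting (3.1.7)
`c_n ≤ Σ_m h_{m+1} h_{n-m}` with the drift weight carried by the tail piece (a half-space walk of length `n - m`),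
the head piece (a half-space walk of length `m + 1`) counted without weight.
[cite: MadrasSlade1993, §3.1, proof of Theorem 3.1.1, eq. (3.1.7); JansevanRensburgWhittington2016, Theorem 3 (method: inclusion/unfolding); drift form not located in print — elementary] -/
theorem driftZ_le_sum_halfSpaceCount_mul_pulledHalfSpaceZ (n : ℕ) {θ : ℝ} (hθ : 0 ≤ θ) :
    driftZ d n θ ≤ ∑ m ∈ Finset.range (n + 1),
      (halfSpaceCount d (m + 1) : ℝ) * pulledHalfSpaceZ d (n - m) (Real.exp θ) := by
  set y : ℝ := Real.exp θ with hy
  have hy0 : 0 ≤ y := (Real.exp_pos θ).le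
  -- the weight on the pieces: `y^{x₁(tail endpoint)}`
  let g : (Σ _ : ℕ, (ℕ → Site d) × (ℕ → Site d)) → ℝ := fun p => y ^ (p.2.2 (n - p.1) 0).toNat
  let G : (ℕ → Site d) → (Σ _ : ℕ, (ℕ → Site d) × (ℕ → Site d)) :=
    fun ω => ⟨lastMin n ω, (headWalk n ω, tailWalk n ω)⟩
  -- (1) termwise
  have step1 : driftZ d n θ ≤ ∑ ω ∈ saws d n, g (G ω) := by
    unfold driftZ
    exact Finset.sum_le_sum fun ω hω => exp_mul_apply_le_pow_tailWalk hω hθ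
  -- (2) reindex along the injective splitting
  have hinj : Set.InjOn G ↑(saws d n) := splitLastMin_injOn n
  have step2 : ∑ ω ∈ saws d n, g (G ω) = ∑ p ∈ (saws d n).image G, g p := by
    rw [Finset.sum_image hinj]
  -- (3) the image lies in `Σ_m H_{m+1} × H_{n-m}`
  let S : Finset (Σ _ : ℕ, (ℕ → Site d) × (ℕ → Site d)) :=
    (Finset.range (n + 1)).sigma fun m => halfSpaceWalks d (m + 1) ×ˢ halfSpaceWalks d (n - m)
  have hsub : (saws d n).image G ⊆ S := by
    intro p hp
    obtain ⟨ω, hω, rfl⟩ := Finset.mem_image.1 hp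
    rw [Finset.mem_sigma, Finset.mem_range, Finset.mem_product]
    exact ⟨Nat.lt_succ_of_le (lastMin_le n ω), headWalk_mem hω, tailWalk_mem hω⟩
  have step3 : ∑ p ∈ (saws d n).image G, g p ≤ ∑ p ∈ S, g p :=
    Finset.sum_le_sum_of_subset_of_nonneg hsub fun _ _ _ => pow_nonneg hy0 _
  -- (4) evaluate the sum over `S`
  have step4 : ∑ p ∈ S, g p = ∑ m ∈ Finset.range (n + 1),
      (halfSpaceCount d (m + 1) : ℝ) * pulledHalfSpaceZ d (n - m) y := by
    rw [Finset.sum_sigma]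
    refine Finset.sum_congr rfl fun m _ => ?_
    rw [Finset.sum_product]
    show ∑ _η ∈ halfSpaceWalks d (m + 1), ∑ τ ∈ halfSpaceWalks d (n - m), y ^ (τ (n - m) 0).toNat = _
    rw [Finset.sum_const, nsmul_eq_mul, halfSpaceCount, pulledHalfSpaceZ]
  calc driftZ d n θ ≤ ∑ ω ∈ saws d n, g (G ω) := step1
    _ = ∑ p ∈ (saws d n).image G, g p := step2
    _ ≤ ∑ p ∈ S, g p := step3
    _ = _ := step4

end FullSpace

section FullSpaceSucc

variable {d : ℕ}

/-- **`Z_n(θ) ≤ (n+1) · e^{6√(n+1)} · Z^B_{n+1}(e^θ)` for `θ ≥ 0`, on `ℤ^{d+1}`** (every dimension): each term of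
`Σ_m h_{m+1} Z^H_{n-m}(y)` is at most `e^{3√(m+1)} b_{m+1} · e^{3√(n-m)} Z^B_{n-m}(y) ≤ e^{6√(n+1)} Z^B_{m+1}(y) Z^B_{n-m}(y)
≤ e^{6√(n+1)} Z^B_{n+1}(y)` (`b ≤ Z^B` for `y ≥ 1`; bridges concatenate). Hence `λ_full-drift(θ) ≤ λ_B(e^θ)`; with
`Z^B ≤ Z^H ≤ Z` the three pulled free energies coincide.
[cite: JansevanRensburgWhittington2016, Theorem 3; MadrasSlade1993, §3.1, eq. (3.1.7) and (1.2.15)] -/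
theorem driftZ_le_mul_exp_mul_pulledBridgeZ_succ (n : ℕ) {θ : ℝ} (hθ : 0 ≤ θ) :
    driftZ (d + 1) n θ ≤
      (n + 1) * Real.exp (6 * Real.sqrt (n + 1)) * pulledBridgeZ (d + 1) (n + 1) (Real.exp θ) := by
  set y : ℝ := Real.exp θ with hy
  have hy1 : 1 ≤ y := by rw [hy]; exact Real.one_le_exp hθ
  have hy0 : 0 ≤ y := zero_le_one.trans hy1
  have h1 := driftZ_le_sum_halfSpaceCount_mul_pulledHalfSpaceZ (d := d + 1) n hθ
  refine h1.trans ?_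
  have hterm : ∀ m ∈ Finset.range (n + 1),
      (halfSpaceCount (d + 1) (m + 1) : ℝ) * pulledHalfSpaceZ (d + 1) (n - m) y ≤
        Real.exp (6 * Real.sqrt (n + 1)) * pulledBridgeZ (d + 1) (n + 1) y := by
    intro m hm
    rw [Finset.mem_range] at hm
    have ha := halfSpaceCount_le_exp_mul_bridgeCount (d := d + 1) (m + 1)
    have hb := pulledHalfSpaceZ_le_exp_mul_pulledBridgeZ (d := d + 1) (n - m) hy1
    have hbb := bridgeCount_le_pulledBridgeZ (d := d + 1) (m + 1) hy1
    have hmn : (m : ℝ) ≤ n := by exact_mod_cast Nat.le_of_lt_succ hm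
    have hsa : Real.sqrt ((m + 1 : ℕ) : ℝ) ≤ Real.sqrt (n + 1) :=
      Real.sqrt_le_sqrt (by push_cast; linarith)
    have hsb : Real.sqrt ((n - m : ℕ) : ℝ) ≤ Real.sqrt (n + 1) :=
      Real.sqrt_le_sqrt (by
        have : ((n - m : ℕ) : ℝ) ≤ n := by exact_mod_cast Nat.sub_le n m
        linarith)
    have hZ1 : 0 ≤ pulledBridgeZ (d + 1) (m + 1) y := pulledBridgeZ_nonneg (m + 1) hy0
    have hZ2 : 0 ≤ pulledBridgeZ (d + 1) (n - m) y := pulledBridgeZ_nonneg (n - m) hy0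
    have hA : (halfSpaceCount (d + 1) (m + 1) : ℝ) ≤
        Real.exp (3 * Real.sqrt (n + 1)) * pulledBridgeZ (d + 1) (m + 1) y :=
      ha.trans ((mul_le_mul_of_nonneg_left hbb (Real.exp_nonneg _)).trans
        (mul_le_mul_of_nonneg_right (Real.exp_le_exp.2 (by linarith)) hZ1))
    have hB : pulledHalfSpaceZ (d + 1) (n - m) y ≤
        Real.exp (3 * Real.sqrt (n + 1)) * pulledBridgeZ (d + 1) (n - m) y :=
      hb.trans (mul_le_mul_of_nonneg_right (Real.exp_le_exp.2 (by linarith)) hZ2)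
    have hH0 : 0 ≤ pulledHalfSpaceZ (d + 1) (n - m) y := by
      unfold pulledHalfSpaceZ; exact Finset.sum_nonneg fun _ _ => pow_nonneg hy0 _
    have hmul := pulledBridgeZ_mul_le d (m + 1) (n - m) hy0
    rw [show m + 1 + (n - m) = n + 1 by omega] at hmul
    calc (halfSpaceCount (d + 1) (m + 1) : ℝ) * pulledHalfSpaceZ (d + 1) (n - m) y
        ≤ (Real.exp (3 * Real.sqrt (n + 1)) * pulledBridgeZ (d + 1) (m + 1) y) *
            (Real.exp (3 * Real.sqrt (n + 1)) * pulledBridgeZ (d + 1) (n - m) y) :=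
          mul_le_mul hA hB hH0 (mul_nonneg (Real.exp_nonneg _) hZ1)
      _ = Real.exp (6 * Real.sqrt (n + 1)) *
            (pulledBridgeZ (d + 1) (m + 1) y * pulledBridgeZ (d + 1) (n - m) y) := by
          rw [show (6 : ℝ) * Real.sqrt (n + 1) = 3 * Real.sqrt (n + 1) + 3 * Real.sqrt (n + 1) by ring,
            Real.exp_add]; ring
      _ ≤ Real.exp (6 * Real.sqrt (n + 1)) * pulledBridgeZ (d + 1) (n + 1) y :=
          mul_le_mul_of_nonneg_left hmul (Real.exp_nonneg _)
  calc ∑ m ∈ Finset.range (n + 1), (halfSpaceCount (d + 1) (m + 1) : ℝ) * pulledHalfSpaceZ (d + 1) (n - m) y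
      ≤ ∑ _m ∈ Finset.range (n + 1), Real.exp (6 * Real.sqrt (n + 1)) * pulledBridgeZ (d + 1) (n + 1) y :=
        Finset.sum_le_sum hterm
    _ = (n + 1) * Real.exp (6 * Real.sqrt (n + 1)) * pulledBridgeZ (d + 1) (n + 1) y := by
        rw [Finset.sum_const, Finset.card_range, nsmul_eq_mul]; push_cast; ring

end FullSpaceSucc


/-! ## The three pulled free energies coincide (`Tendsto` form) -/

section Limits

open Filter Topology

/-- `√N / N → 0`. [folklore] -/
private theorem tendsto_sqrt_div_self_natCast :
    Tendsto (fun N : ℕ => Real.sqrt N / (N : ℝ)) atTop (𝓝 0) := by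
  have h : Tendsto (fun N : ℕ => (Real.sqrt (N : ℝ))⁻¹) atTop (𝓝 0) :=
    tendsto_inv_atTop_zero.comp (Real.tendsto_sqrt_atTop.comp tendsto_natCast_atTop_atTop)
  refine h.congr fun N => ?_
  rw [Real.sqrt_div_self]

/-- `√(N+1) / N → 0`. [folklore] -/
private theorem tendsto_sqrt_succ_div_natCast :
    Tendsto (fun N : ℕ => Real.sqrt ((N : ℝ) + 1) / (N : ℝ)) atTop (𝓝 0) := by
  -- `√(N+1)/N = (√(N+1)/(N+1)) · ((N+1)/N)` for `N ≥ 1`, and `(N+1)/N → 1`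
  have h1 : Tendsto (fun N : ℕ => Real.sqrt ((N : ℝ) + 1) / ((N : ℝ) + 1)) atTop (𝓝 0) := by
    have := tendsto_sqrt_div_self_natCast.comp (tendsto_add_atTop_nat 1)
    refine this.congr fun N => ?_
    simp [Function.comp, Nat.cast_succ]
  have h2 : Tendsto (fun N : ℕ => ((N : ℝ) + 1) / (N : ℝ)) atTop (𝓝 1) := by
    have h0 : Tendsto (fun N : ℕ => (1 : ℝ) + 1 / (N : ℝ)) atTop (𝓝 1) := by
      simpa using (tendsto_const_div_atTop_nhds_zero_nat (1 : ℝ)).const_add (1 : ℝ)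
    refine h0.congr' ?_
    filter_upwards [eventually_ge_atTop 1] with N hN
    have hN' : (N : ℝ) ≠ 0 := by exact_mod_cast (Nat.one_le_iff_ne_zero.1 hN)
    field_simp
  have h := h1.mul h2
  rw [zero_mul] at h
  refine h.congr' ?_
  filter_upwards [eventually_ge_atTop 1] with N hN
  have hN' : (N : ℝ) ≠ 0 := by exact_mod_cast (Nat.one_le_iff_ne_zero.1 hN)
  have hN1 : (N : ℝ) + 1 ≠ 0 := by positivity
  field_simp

variable {d : ℕ}

/-- **Bridges and half-space walks have the same pulled free energy (`y ≥ 1`)**: if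
`N⁻¹ log Z^B_N(y) → λ` then `N⁻¹ log Z^H_N(y) → λ` (squeeze between `Z^B_N ≤ Z^H_N ≤ e^{3√N} Z^B_N`).
[cite: JansevanRensburgWhittington2016, Theorem 3] -/
theorem tendsto_log_pulledHalfSpaceZ_div_of_pulledBridgeZ (d : ℕ) {y lam : ℝ} (hy : 1 ≤ y)
    (h : Tendsto (fun N : ℕ => Real.log (pulledBridgeZ (d + 1) N y) / N) atTop (𝓝 lam)) :
    Tendsto (fun N : ℕ => Real.log (pulledHalfSpaceZ (d + 1) N y) / N) atTop (𝓝 lam) := by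
  have hy0 : 0 < y := zero_lt_one.trans_le hy
  have hB : ∀ N, 0 < pulledBridgeZ (d + 1) N y := fun N => pulledBridgeZ_pos d N hy0
  have hBH : ∀ N, pulledBridgeZ (d + 1) N y ≤ pulledHalfSpaceZ (d + 1) N y := fun N => by
    have := (pulledBridgeZ_le_pulledHalfSpaceZ_le_driftZ d N (Real.log y)).1
    rwa [Real.exp_log hy0] at this
  have hH : ∀ N, 0 < pulledHalfSpaceZ (d + 1) N y := fun N => (hB N).trans_le (hBH N)
  -- upper sequence
  have hup : Tendsto (fun N : ℕ => 3 * (Real.sqrt N / (N : ℝ)) +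
      Real.log (pulledBridgeZ (d + 1) N y) / N) atTop (𝓝 lam) := by
    have := (tendsto_sqrt_div_self_natCast.const_mul 3).add h
    simpa using this
  refine tendsto_of_tendsto_of_tendsto_of_le_of_le h hup (fun N => ?_) (fun N => ?_)
  · exact div_le_div_of_nonneg_right (Real.log_le_log (hB N) (hBH N)) (Nat.cast_nonneg N)
  · have h1 := pulledHalfSpaceZ_le_exp_mul_pulledBridgeZ (d := d + 1) N hy
    have h2 : Real.log (pulledHalfSpaceZ (d + 1) N y) ≤
        3 * Real.sqrt N + Real.log (pulledBridgeZ (d + 1) N y) := by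
      have := Real.log_le_log (hH N) h1
      rwa [Real.log_mul (Real.exp_pos _).ne' (hB N).ne', Real.log_exp] at this
    have h3 := div_le_div_of_nonneg_right h2 (Nat.cast_nonneg N)
    rw [add_div, mul_div_assoc] at h3
    exact h3

/-- **Bridges and drifted (full-space) walks have the same pulled free energy (`θ ≥ 0`)**: if
`N⁻¹ log Z^B_N(e^θ) → λ` then `N⁻¹ log Z_N(θ) → λ` (squeeze between `Z^B_N ≤ Z_N ≤ (N+1) e^{6√(N+1)} Z^B_{N+1}`).
Together with the previous theorem: the three pulled free energies coincide whenever the bridge one exists.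
[cite: JansevanRensburgWhittington2016, Theorem 3; MadrasSlade1993, §3.1, eq. (3.1.7)] -/
theorem tendsto_log_driftZ_div_of_pulledBridgeZ (d : ℕ) {θ lam : ℝ} (hθ : 0 ≤ θ)
    (h : Tendsto (fun N : ℕ => Real.log (pulledBridgeZ (d + 1) N (Real.exp θ)) / N) atTop (𝓝 lam)) :
    Tendsto (fun N : ℕ => Real.log (driftZ (d + 1) N θ) / N) atTop (𝓝 lam) := by
  set y : ℝ := Real.exp θ with hy
  have hy0 : 0 < y := Real.exp_pos θ
  have hB : ∀ N, 0 < pulledBridgeZ (d + 1) N y := fun N => pulledBridgeZ_pos d N hy0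
  have hBZ : ∀ N, pulledBridgeZ (d + 1) N y ≤ driftZ (d + 1) N θ := fun N =>
    (pulledBridgeZ_le_pulledHalfSpaceZ_le_driftZ d N θ).1.trans
      (pulledBridgeZ_le_pulledHalfSpaceZ_le_driftZ d N θ).2
  have hZ : ∀ N, 0 < driftZ (d + 1) N θ := fun N => (hB N).trans_le (hBZ N)
  -- the shifted bridge sequence: `log Z^B_{N+1} / (N+1) → λ`
  have hshift : Tendsto (fun N : ℕ => Real.log (pulledBridgeZ (d + 1) (N + 1) y) / ((N : ℝ) + 1))
      atTop (𝓝 lam) := by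
    have := h.comp (tendsto_add_atTop_nat 1)
    refine this.congr fun N => ?_
    simp [Function.comp, Nat.cast_succ]
  have hratio : Tendsto (fun N : ℕ => ((N : ℝ) + 1) / (N : ℝ)) atTop (𝓝 1) := by
    have h0 : Tendsto (fun N : ℕ => (1 : ℝ) + 1 / (N : ℝ)) atTop (𝓝 1) := by
      simpa using (tendsto_const_div_atTop_nhds_zero_nat (1 : ℝ)).const_add (1 : ℝ)
    refine h0.congr' ?_
    filter_upwards [eventually_ge_atTop 1] with N hN
    have hN' : (N : ℝ) ≠ 0 := by exact_mod_cast (Nat.one_le_iff_ne_zero.1 hN)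
    field_simp
  -- upper sequence: `8 √(N+1)/N + (log Z^B_{N+1}/(N+1)) · ((N+1)/N) → 0 + λ·1`
  have hup : Tendsto (fun N : ℕ => 8 * (Real.sqrt ((N : ℝ) + 1) / (N : ℝ)) +
      Real.log (pulledBridgeZ (d + 1) (N + 1) y) / ((N : ℝ) + 1) * (((N : ℝ) + 1) / (N : ℝ)))
      atTop (𝓝 lam) := by
    have := (tendsto_sqrt_succ_div_natCast.const_mul 8).add (hshift.mul hratio)
    simpa using this
  refine tendsto_of_tendsto_of_tendsto_of_le_of_le' h hup
    (Eventually.of_forall fun N => ?_) ?_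
  · exact div_le_div_of_nonneg_right (Real.log_le_log (hB N) (hBZ N)) (Nat.cast_nonneg N)
  · filter_upwards [eventually_ge_atTop 1] with N hN
    have hN' : (0 : ℝ) < N := by exact_mod_cast hN
    have h1 := driftZ_le_mul_exp_mul_pulledBridgeZ_succ (d := d) N hθ
    -- `log Z_N ≤ log(N+1) + 6√(N+1) + log Z^B_{N+1}`
    have hpos1 : (0 : ℝ) < (N : ℝ) + 1 := by positivity
    have h2 : Real.log (driftZ (d + 1) N θ) ≤
        Real.log ((N : ℝ) + 1) + 6 * Real.sqrt ((N : ℝ) + 1) +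
          Real.log (pulledBridgeZ (d + 1) (N + 1) y) := by
      have := Real.log_le_log (hZ N) h1
      rw [Real.log_mul (by positivity) (hB (N + 1)).ne', Real.log_mul hpos1.ne' (Real.exp_pos _).ne',
        Real.log_exp] at this
      exact this
    -- `log(N+1) ≤ 2√(N+1)`
    have h3 : Real.log ((N : ℝ) + 1) ≤ 2 * Real.sqrt ((N : ℝ) + 1) := by
      have := Real.log_le_rpow_div hpos1.le (by norm_num : (0 : ℝ) < 1 / 2)
      rw [← Real.sqrt_eq_rpow] at this
      linarith
    have h4 : Real.log (driftZ (d + 1) N θ) ≤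
        8 * Real.sqrt ((N : ℝ) + 1) + Real.log (pulledBridgeZ (d + 1) (N + 1) y) := by linarith
    have h5 := div_le_div_of_nonneg_right h4 hN'.le
    refine h5.trans (le_of_eq ?_)
    field_simp

end Limits


/-! ## Any intermediate ensemble (e.g. Beaton's weak-half-space `U_n(y)`, JvR–W's `C⁺_n`) is sandwiched -/

section Sandwich

open Filter Topology

variable {d : ℕ}

/-- For any family `T` of `N`-step self-avoiding walks with non-negative endpoint level (e.g. the WEAK
half-space walks `x₁ ≥ 0` of Beaton's `U_N(y)`, or M–S half-space walks), the pulled sum is at most the drifted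
partition function over all walks: `Σ_{ω ∈ T} (e^θ)^{x₁(ω_N)} ≤ Z_N(θ)`.
[cite: JansevanRensburgWhittington2016, Theorem 3 (proof: "B(y,z) ≤ C⁺(y,z) ≤ C(y,z)" by inclusion)] -/
theorem sum_pow_le_driftZ_of_subset [NeZero d] {N : ℕ} {T : Finset (ℕ → Site d)} (hT : T ⊆ saws d N)
    (hpos : ∀ ω ∈ T, 0 ≤ ω N 0) (θ : ℝ) :
    ∑ ω ∈ T, Real.exp θ ^ (ω N 0).toNat ≤ driftZ d N θ := by
  classical
  unfold driftZ
  calc ∑ ω ∈ T, Real.exp θ ^ (ω N 0).toNat = ∑ ω ∈ T, Real.exp (θ * ((ω N 0 : ℤ) : ℝ)) := by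
        refine Finset.sum_congr rfl fun ω hω => ?_
        have h0 := hpos ω hω
        have hcast : (((ω N 0).toNat : ℕ) : ℝ) = ((ω N 0 : ℤ) : ℝ) := by
          have : (((ω N 0).toNat : ℕ) : ℤ) = ω N 0 := Int.toNat_of_nonneg h0
          exact_mod_cast this
        rw [← Real.exp_nat_mul, hcast, mul_comm]
    _ ≤ ∑ ω ∈ saws d N, Real.exp (θ * ((ω N 0 : ℤ) : ℝ)) :=
        Finset.sum_le_sum_of_subset_of_nonneg hT fun _ _ _ => (Real.exp_pos _).le

/-- … and at least the pulled bridge partition function when `T` contains the bridges: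
`Z^B_N(y) ≤ Σ_{ω ∈ T} y^{x₁(ω_N)}` (`y ≥ 0`). [cite: JansevanRensburgWhittington2016, Theorem 3 (proof: inclusion)] -/
theorem pulledBridgeZ_le_sum_pow_of_bridges_subset [NeZero d] {N : ℕ} {T : Finset (ℕ → Site d)}
    (hB : bridges d N ⊆ T) {y : ℝ} (hy : 0 ≤ y) :
    pulledBridgeZ d N y ≤ ∑ ω ∈ T, y ^ (ω N 0).toNat := by
  rw [pulledBridgeZ_eq_sum_bridges]
  exact Finset.sum_le_sum_of_subset_of_nonneg hB fun _ _ _ => pow_nonneg hy _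

/-- **Every pulled ensemble between the bridges and all walks has the bridge free energy (`θ ≥ 0`)**: if
`bridges ⊆ T_N ⊆ saws` with non-negative endpoint levels (Beaton's `U_N`, the tree's `Z^H_N`, …) and
`N⁻¹ log Z^B_N(e^θ) → λ`, then `N⁻¹ log Σ_{ω ∈ T_N} (e^θ)^{x₁(ω_N)} → λ`.
[cite: JansevanRensburgWhittington2016, Theorem 3] -/
theorem tendsto_log_sum_pow_div_of_pulledBridgeZ (d : ℕ) {θ lam : ℝ} (hθ : 0 ≤ θ)
    (T : ℕ → Finset (ℕ → Site (d + 1))) (hT : ∀ N, T N ⊆ saws (d + 1) N)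
    (hB : ∀ N, bridges (d + 1) N ⊆ T N) (hpos : ∀ N, ∀ ω ∈ T N, 0 ≤ ω N 0)
    (h : Tendsto (fun N : ℕ => Real.log (pulledBridgeZ (d + 1) N (Real.exp θ)) / N) atTop (𝓝 lam)) :
    Tendsto (fun N : ℕ => Real.log (∑ ω ∈ T N, Real.exp θ ^ (ω N 0).toNat) / N) atTop (𝓝 lam) := by
  have hy0 : 0 < Real.exp θ := Real.exp_pos θ
  have hBpos : ∀ N, 0 < pulledBridgeZ (d + 1) N (Real.exp θ) := fun N => pulledBridgeZ_pos d N hy0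
  have hlo : ∀ N, pulledBridgeZ (d + 1) N (Real.exp θ) ≤ ∑ ω ∈ T N, Real.exp θ ^ (ω N 0).toNat :=
    fun N => pulledBridgeZ_le_sum_pow_of_bridges_subset (hB N) hy0.le
  have hhi : ∀ N, ∑ ω ∈ T N, Real.exp θ ^ (ω N 0).toNat ≤ driftZ (d + 1) N θ :=
    fun N => sum_pow_le_driftZ_of_subset (hT N) (hpos N) θ
  have hTpos : ∀ N, 0 < ∑ ω ∈ T N, Real.exp θ ^ (ω N 0).toNat := fun N => (hBpos N).trans_le (hlo N)
  refine tendsto_of_tendsto_of_tendsto_of_le_of_le h (tendsto_log_driftZ_div_of_pulledBridgeZ d hθ h)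
    (fun N => ?_) (fun N => ?_)
  · exact div_le_div_of_nonneg_right (Real.log_le_log (hBpos N) (hlo N)) (Nat.cast_nonneg N)
  · exact div_le_div_of_nonneg_right (Real.log_le_log (hTpos N) (hhi N)) (Nat.cast_nonneg N)

end Sandwich


/-! ## With the bridge free energy `λ_B` (X29, `SAWPulledBridgeFreeEnergy.lean`): the three pulled free
energies EXIST and are EQUAL, and — AS PRINTED — the three generating functions have the same radius of
convergence `e^{-λ_B(y)}` (Janse van Rensburg–Whittington 2016, Theorem 3) -/

section WithFreeEnergy

open Filter Topology

variable {d : ℕ}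

/-- **Half-space pulled free energy = bridge pulled free energy**: `N⁻¹ log Z^H_N(y) → λ_B(y)` for `y ≥ 1`, every
dimension. [cite: JansevanRensburgWhittington2016, Theorem 3] -/
theorem tendsto_log_pulledHalfSpaceZ_div (d : ℕ) {y : ℝ} (hy : 1 ≤ y) :
    Tendsto (fun N : ℕ => Real.log (pulledHalfSpaceZ (d + 1) N y) / N) atTop
      (𝓝 (pulledBridgeFreeEnergy (d + 1) y)) :=
  tendsto_log_pulledHalfSpaceZ_div_of_pulledBridgeZ d hy
    (tendsto_pulledBridgeFreeEnergy d (zero_lt_one.trans_le hy))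

/-- **Drifted (full-space) pulled free energy = bridge pulled free energy**: `N⁻¹ log Z_N(θ) → λ_B(e^θ)` for
`θ ≥ 0`, every dimension. [cite: JansevanRensburgWhittington2016, Theorem 3; IoffeVelenik2008, §1.1 (the drifted ensemble)] -/
theorem tendsto_log_driftZ_div (d : ℕ) {θ : ℝ} (hθ : 0 ≤ θ) :
    Tendsto (fun N : ℕ => Real.log (driftZ (d + 1) N θ) / N) atTop
      (𝓝 (pulledBridgeFreeEnergy (d + 1) (Real.exp θ))) :=
  tendsto_log_driftZ_div_of_pulledBridgeZ d hθ (tendsto_pulledBridgeFreeEnergy d (Real.exp_pos θ))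

/-- **Any sandwiched ensemble** (`bridges ⊆ T_N ⊆ saws`, endpoint levels `≥ 0` — e.g. Beaton's weak-half-space
`U_N(y)`): `N⁻¹ log Σ_{ω ∈ T_N} (e^θ)^{x₁(ω_N)} → λ_B(e^θ)` for `θ ≥ 0`.
[cite: JansevanRensburgWhittington2016, Theorem 3; Beaton2015, §2 (U_n(y))] -/
theorem tendsto_log_sum_pow_div (d : ℕ) {θ : ℝ} (hθ : 0 ≤ θ)
    (T : ℕ → Finset (ℕ → Site (d + 1))) (hT : ∀ N, T N ⊆ saws (d + 1) N)
    (hB : ∀ N, bridges (d + 1) N ⊆ T N) (hpos : ∀ N, ∀ ω ∈ T N, 0 ≤ ω N 0) :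
    Tendsto (fun N : ℕ => Real.log (∑ ω ∈ T N, Real.exp θ ^ (ω N 0).toNat) / N) atTop
      (𝓝 (pulledBridgeFreeEnergy (d + 1) (Real.exp θ))) :=
  tendsto_log_sum_pow_div_of_pulledBridgeZ d hθ T hT hB hpos
    (tendsto_pulledBridgeFreeEnergy d (Real.exp_pos θ))

/-! ### Radius of convergence from the free energy (Cauchy–Hadamard, root-test form) -/

/-- If `a_N > 0` and `N⁻¹ log a_N → λ`, then `Σ_N a_N r^N` converges for `0 ≤ r < e^{-λ}`. [folklore] -/
private theorem summable_mul_pow_of_tendsto_log_div {a : ℕ → ℝ} {lam r : ℝ} (ha : ∀ N, 0 < a N)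
    (h : Tendsto (fun N : ℕ => Real.log (a N) / N) atTop (𝓝 lam)) (hr0 : 0 ≤ r)
    (hr : r < Real.exp (-lam)) : Summable fun N => a N * r ^ N := by
  rcases hr0.eq_or_lt with rfl | hr0'
  · refine summable_of_ne_finset_zero (s := {0}) fun N hN => ?_
    rw [Finset.mem_singleton] at hN
    simp [zero_pow hN]
  have hlog : Real.log r < -lam := by
    have := Real.log_lt_log hr0' hr
    rwa [Real.log_exp] at this
  set ε : ℝ := (-lam - Real.log r) / 2 with hε
  have hεpos : 0 < ε := by rw [hε]; linarith
  set q : ℝ := Real.exp (lam + ε) * r with hq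
  have hq0 : 0 ≤ q := mul_nonneg (Real.exp_pos _).le hr0
  have hq1 : q < 1 := by
    have : Real.log q < 0 := by
      rw [hq, Real.log_mul (Real.exp_pos _).ne' hr0'.ne', Real.log_exp]; linarith
    have hqpos : 0 < q := mul_pos (Real.exp_pos _) hr0'
    have := Real.exp_lt_exp.2 this
    rwa [Real.exp_log hqpos, Real.exp_zero] at this
  have hgeom : Summable fun N : ℕ => q ^ N := summable_geometric_of_lt_one hq0 hq1
  have hev : ∀ᶠ N : ℕ in atTop, Real.log (a N) / N < lam + ε :=
    h (Iio_mem_nhds (by linarith))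
  refine Summable.of_norm_bounded_eventually_nat hgeom ?_
  filter_upwards [hev, eventually_gt_atTop 0] with N hN hNpos
  have hNr : (0 : ℝ) < N := by exact_mod_cast hNpos
  rw [Real.norm_of_nonneg (mul_nonneg (ha N).le (pow_nonneg hr0 N))]
  have h1 : Real.log (a N) < N * (lam + ε) := by
    rwa [div_lt_iff₀ hNr, mul_comm] at hN
  have h2 : a N < Real.exp (lam + ε) ^ N := by
    rw [← Real.exp_nat_mul, ← Real.exp_log (ha N)]
    exact Real.exp_lt_exp.2 h1
  calc a N * r ^ N ≤ Real.exp (lam + ε) ^ N * r ^ N :=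
        mul_le_mul_of_nonneg_right h2.le (pow_nonneg hr0 N)
    _ = q ^ N := by rw [hq, mul_pow]

/-- If `a_N > 0` and `N⁻¹ log a_N → λ`, then `Σ_N a_N r^N` diverges for `r > e^{-λ}`. [folklore] -/
private theorem not_summable_mul_pow_of_tendsto_log_div {a : ℕ → ℝ} {lam r : ℝ} (ha : ∀ N, 0 < a N)
    (h : Tendsto (fun N : ℕ => Real.log (a N) / N) atTop (𝓝 lam))
    (hr : Real.exp (-lam) < r) : ¬ Summable fun N => a N * r ^ N := by
  have hr0 : 0 < r := (Real.exp_pos _).trans hr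
  have hlog : -lam < Real.log r := by
    have := Real.log_lt_log (Real.exp_pos _) hr
    rwa [Real.log_exp] at this
  set ε : ℝ := (lam + Real.log r) / 2 with hε
  have hεpos : 0 < ε := by rw [hε]; linarith
  intro hsum
  have hzero := hsum.tendsto_atTop_zero
  have hev : ∀ᶠ N : ℕ in atTop, lam - ε < Real.log (a N) / N :=
    h (Ioi_mem_nhds (by linarith))
  have hev2 : ∀ᶠ N : ℕ in atTop, (1 : ℝ) ≤ a N * r ^ N := by
    filter_upwards [hev, eventually_gt_atTop 0] with N hN hNpos
    have hNr : (0 : ℝ) < N := by exact_mod_cast hNpos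
    have h1 : N * (lam - ε) < Real.log (a N) := by
      rwa [lt_div_iff₀ hNr, mul_comm] at hN
    have h2 : Real.exp (lam - ε) ^ N < a N := by
      rw [← Real.exp_nat_mul, ← Real.exp_log (ha N)]
      exact Real.exp_lt_exp.2 h1
    have hq1 : 1 ≤ Real.exp (lam - ε) * r := by
      have : 0 ≤ Real.log (Real.exp (lam - ε) * r) := by
        rw [Real.log_mul (Real.exp_pos _).ne' hr0.ne', Real.log_exp]; linarith
      have hpos : 0 < Real.exp (lam - ε) * r := mul_pos (Real.exp_pos _) hr0
      have := Real.exp_le_exp.2 this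
      rwa [Real.exp_zero, Real.exp_log hpos] at this
    calc (1 : ℝ) ≤ (Real.exp (lam - ε) * r) ^ N := one_le_pow₀ hq1
      _ = Real.exp (lam - ε) ^ N * r ^ N := mul_pow _ _ _
      _ ≤ a N * r ^ N := mul_le_mul_of_nonneg_right h2.le (pow_nonneg hr0.le N)
  have hlt : ∀ᶠ N : ℕ in atTop, a N * r ^ N < 1 := hzero (Iio_mem_nhds zero_lt_one)
  obtain ⟨N, h1, h2⟩ := (hev2.and hlt).exists
  linarith

/-- **Janse van Rensburg–Whittington 2016, Theorem 3 — radius-of-convergence form for the tree's BRIDGE and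
HEIGHT-weighted ensembles (NOT the printed triple), every dimension `d + 1 ≥ 1`, every `y ≥ 1`.** Printed
(Theorem 3): "The radii of convergence of the generating functions `C(y,z)`, `C⁺(y,z)` and `B(y,z)` are all equal
when `y ≥ 1`", where `C` = positive walks weighted `y^{span}`, `C⁺` = positive walks weighted `y^{endpoint height}`,
`B` = bridges. Proved HERE: the three power series `Σ_N Z^B_N(y) z^N` (bridges — the printed `B`),
`Σ_N Z^H_N(y) z^N` (the tree's STRICT half-space walks, endpoint-height weight — a sub-ensemble of the printed `C⁺`)
and `Σ_N Z_N(log y) z^N` (ALL walks with drift `log y` — not one of the printed ensembles) each CONVERGE for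
`0 ≤ z < e^{-λ_B(y)}` and DIVERGE for `z > e^{-λ_B(y)}`, i.e. these three radii equal `e^{-λ_B(y)}`
(`λ_B` = `pulledBridgeFreeEnergy`; Cauchy–Hadamard from the free-energy limits above). **The span-weighted ensemble
`C(y,z)` of the printed theorem is not typed here.** The printed `C⁺` (weak half-space walks, height weight =
Beaton's `U_n`) lies between `Z^B_N` and `Z_N(log y)` and is covered by `tendsto_log_sum_pow_div`.
[cite: JansevanRensburgWhittington2016, Theorem 3 (J. Phys. A 49 (2016) 11LT01, p. 4; arXiv:1510.06698 p0005:L22–L49) — bridge/height part] -/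
theorem JansevanRensburgWhittington2016_thm3_bridge_height (d : ℕ) {y : ℝ} (hy : 1 ≤ y) :
    (∀ z : ℝ, 0 ≤ z → z < Real.exp (-pulledBridgeFreeEnergy (d + 1) y) →
        Summable (fun N : ℕ => pulledBridgeZ (d + 1) N y * z ^ N) ∧
        Summable (fun N : ℕ => pulledHalfSpaceZ (d + 1) N y * z ^ N) ∧
        Summable (fun N : ℕ => driftZ (d + 1) N (Real.log y) * z ^ N)) ∧
    (∀ z : ℝ, Real.exp (-pulledBridgeFreeEnergy (d + 1) y) < z →
        ¬ Summable (fun N : ℕ => pulledBridgeZ (d + 1) N y * z ^ N) ∧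
        ¬ Summable (fun N : ℕ => pulledHalfSpaceZ (d + 1) N y * z ^ N) ∧
        ¬ Summable (fun N : ℕ => driftZ (d + 1) N (Real.log y) * z ^ N)) := by
  have hy0 : 0 < y := zero_lt_one.trans_le hy
  have hθ : 0 ≤ Real.log y := Real.log_nonneg hy
  -- positivity of the three sequences
  have hB : ∀ N, 0 < pulledBridgeZ (d + 1) N y := fun N => pulledBridgeZ_pos d N hy0
  have hsand : ∀ N, pulledBridgeZ (d + 1) N y ≤ pulledHalfSpaceZ (d + 1) N y ∧
      pulledHalfSpaceZ (d + 1) N y ≤ driftZ (d + 1) N (Real.log y) := fun N => by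
    have := pulledBridgeZ_le_pulledHalfSpaceZ_le_driftZ d N (Real.log y)
    rwa [Real.exp_log hy0] at this
  have hH : ∀ N, 0 < pulledHalfSpaceZ (d + 1) N y := fun N => (hB N).trans_le (hsand N).1
  have hZ : ∀ N, 0 < driftZ (d + 1) N (Real.log y) := fun N => (hH N).trans_le (hsand N).2
  -- the three free-energy limits (all equal to λ_B(y))
  have tB := tendsto_pulledBridgeFreeEnergy d hy0
  have tH := tendsto_log_pulledHalfSpaceZ_div d hy
  have tZ : Tendsto (fun N : ℕ => Real.log (driftZ (d + 1) N (Real.log y)) / N) atTop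
      (𝓝 (pulledBridgeFreeEnergy (d + 1) y)) := by
    have := tendsto_log_driftZ_div d hθ
    rwa [Real.exp_log hy0] at this
  refine ⟨fun z hz0 hz => ⟨?_, ?_, ?_⟩, fun z hz => ⟨?_, ?_, ?_⟩⟩
  · exact summable_mul_pow_of_tendsto_log_div hB tB hz0 hz
  · exact summable_mul_pow_of_tendsto_log_div hH tH hz0 hz
  · exact summable_mul_pow_of_tendsto_log_div hZ tZ hz0 hz
  · exact not_summable_mul_pow_of_tendsto_log_div hB tB hz
  · exact not_summable_mul_pow_of_tendsto_log_div hH tH hz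
  · exact not_summable_mul_pow_of_tendsto_log_div hZ tZ hz

end WithFreeEnergy

end Literature.Probability.RandomPlanarGeometry.SAW.Zd
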